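import Summits.Parity.GeneralizedHardyLittlewood.Theorems.FordMaynardNoSieveConst0164NegWitness0164BlockWeightSmall
import Summits.Parity.GeneralizedHardyLittlewood.Theorems.FordMaynardNoSieveConst0164NegWitness0164FragOpOne
import Literature.NumberTheory.Sieve.FordMaynardFragmentationForward
import Literature.NumberTheory.Sieve.FordMaynardSliceConvolution
import Literature.NumberTheory.Sieve.FordMaynardFragOpSymm

/-!
# Route `FordMaynardNoSieveConst0164`, crux `NegWitness0164` (stmt-Parity-19102), line `birth`,
# stub `stub_tweakNeg0164`: small coordinates pass through the fragmentation operator ((fsl))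

Helper file toward the certificate stub (K. Ford, J. Maynard, *On the theory of prime producing sieves*,
arXiv:2407.14368, §6.1, the remark after (6.3): "only the components `≥ 1 - γ` are genuinely fragmented").
For data `g` (bounded, measurable in each dimension) and `0 < η`:

* `fragOp_snoc_small` — **one small coordinate passes through**: for `η ≤ b < 1 - γ` and any `ζ ∈ ℝ^m`,
  `fragOp γ η g (ζ, b) = fragOp γ η g_b (ζ)` with `g_b(v) = g(v, b)`: in (6.3) the block of `b` has weight
  `𝟙[k = 1]/b` (Lemma 5.5 (b)), which cancels the factor `b` of `ξ₁⋯ξ_{m+1}`;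
* `fragOp_append_small` — the same for finitely many small coordinates `b ∈ [η, 1 - γ)^s` appended:
  `fragOp γ η g (ζ, b) = fragOp γ η g_b (ζ)`, `g_b(v) = g(v, b)`;
* `fragOp_one_append_small_eq_sum_sliceIntegral` — **the printed (fsl) with one large coordinate**:
  `fragOp γ η g (α, b) = α ∑_{n=1}^{⌊1/η⌋} ∫_{v ∈ Δ_n(α)} 𝟙[v ≥ η] 𝓛_{1-γ}(v)/(n! v₁⋯v_n) g(v, b) dv`
  for `b ∈ [η, 1 - γ)^s` (the `n = 1` term vanishes when `α ≥ 1 - γ`, Lemma 5.5 (a));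
* `fragOp_eq_sum_sliceIntegral_of_others_small` — the same at a vector `ξ ∈ ℝ^{s+1}` with a distinguished
  coordinate `j` and all other coordinates small, for `g ∈ 𝒮` (Ford–Maynard's `f_{s,1}(β, α)` with `α = ξ_j`,
  `β = ξ_{≠ j}`, whatever the position of `α`).

These are the dimension-generic form of census item R1 (the dims `≥ 2` clause of the stub is `fragOp ≥ -1` at
vectors with one component `≥ 1/2`, `stub_lower_of_0164`).  Def-free.

References: [FordMaynard2024PrimeSieves] arXiv:2407.14368, §6.1 (6.3)/(fsl), Lemma 5.5, §8.
-/

noncomputable section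

open Finset MeasureTheory
open scoped Classical
open Literature.Combinatorics.Enumerative
open Literature.NumberTheory.Sieve Literature.NumberTheory.Sieve.FordMaynard

namespace Summit.Parity.GeneralizedHardyLittlewood.FordMaynardNoSieveConst0164NegWitness0164

variable {γ η : ℝ}

/-- Freezing the last coordinate of bounded measurable data gives bounded measurable data. [folklore] -/
theorem measurable_snoc_data (g : VecFn) (hgm : ∀ n, Measurable (g n)) (b : ℝ) (n : ℕ) :
    Measurable (fun v : Fin n → ℝ => g (n + 1) (Fin.snoc (α := fun _ => ℝ) v b)) :=
  (hgm (n + 1)).comp (measurable_snoc.comp (measurable_id.prodMk measurable_const))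

/-- Freezing the last coordinate at `b` commutes with the casts of (6.3): `g(β', b)` in dimension
`bsum m kv' + 1` is `g_b` in dimension `∑ kv'` at `β' ∘ cast`. [folklore] -/
theorem apply_snoc_eq_cast (g : VecFn) {m : ℕ} (kv' : Fin m → ℕ) (β' : Fin (bsum m kv') → ℝ) (b : ℝ) :
    g (bsum m kv' + 1) (Fin.snoc (α := fun _ => ℝ) β' b) =
      g ((∑ j, kv' j) + 1) (Fin.snoc (α := fun _ => ℝ) (β' ∘ Fin.cast (bsum_eq_sum m kv').symm) b) := by
  rw [snoc_comp_cast (bsum_eq_sum m kv').symm β' b]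
  exact VecFn.apply_congr g (by rw [bsum_eq_sum]) _ _ fun i =>
    congrArg (Fin.snoc (α := fun _ => ℝ) β' b) (Fin.ext rfl)

/-- **One small coordinate passes through the fragmentation operator**: for `0 < η ≤ b < 1 - γ`,
`g` bounded and measurable in each dimension, and any `ζ ∈ ℝ^m`,
`fragOp γ η g (ζ, b) = fragOp γ η g_b (ζ)` where `g_b(v) = g(v, b)` (in (6.3) the block of the small
coordinate `b` is not fragmented and carries the weight `1/b`).
[cite: FordMaynard2024PrimeSieves, §6.1 (remarks after (6.3)) and Theorem 6.4 (fsl)] -/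
theorem fragOp_snoc_small (hη : 0 < η) (hη1 : η ≤ 1) (g : VecFn) (hgm : ∀ n, Measurable (g n)) {F : ℝ}
    (hF : ∀ n v, |g n v| ≤ F) {m : ℕ} (ζ : Fin m → ℝ) {b : ℝ} (hb : η ≤ b) (hb' : b < 1 - γ) :
    fragOp γ η g (m + 1) (Fin.snoc (α := fun _ => ℝ) ζ b) =
      fragOp γ η (fun n v => g (n + 1) (Fin.snoc (α := fun _ => ℝ) v b)) m ζ := by
  have hb0 : 0 < b := hη.trans_le hb
  have hN : 1 ≤ maxBlock η := by
    unfold maxBlock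
    refine Nat.le_floor ?_
    rw [Nat.cast_one, le_div_iff₀ hη, one_mul]
    exact hη1
  set g' : VecFn := fun n v => g (n + 1) (Fin.snoc (α := fun _ => ℝ) v b) with hg'
  have hgm' : ∀ n, Measurable (g' n) := measurable_snoc_data g hgm b
  have hF' : ∀ n v, |g' n v| ≤ F := fun n v => hF _ _
  rw [fragOp_eq_multiSlice hη g hgm hF (m + 1) _, fragOp_eq_multiSlice hη g' hgm' hF' m ζ,
    Fin.prod_univ_castSucc]
  simp only [Fin.snoc_castSucc, Fin.snoc_last]
  -- the summand for block sizes `kv`, peeled: a function of `(init kv, kv last)`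
  set S : Finset ℕ := Finset.Icc 1 (maxBlock η) with hS
  set Fs : (Fin m → ℕ) → ℕ → ℝ := fun kv' k => multiSlice m kv' ζ (fun β' => sliceIntegral k b
    (fun v => if (∀ t, η ≤ β' t) ∧ (∀ i, η ≤ v i) then
      (∏ j : Fin m, blockWeight γ (kv' j) (fun i =>
          β' (Fin.cast (bsum_eq_sum m kv').symm (finSigmaFinEquiv (n := kv') ⟨j, i⟩)))) *
        blockWeight γ k v * g (bsum m kv' + k) (Fin.append β' v) else 0)) with hFs
  have hpeel : ∀ kv : Fin (m + 1) → ℕ,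
      multiSlice (m + 1) kv (Fin.snoc (α := fun _ => ℝ) ζ b) (fun β => if ∀ t, η ≤ β t then
        (∏ j, blockWeight γ (kv j) (fun i =>
            β (Fin.cast (bsum_eq_sum (m + 1) kv).symm (finSigmaFinEquiv (n := kv) ⟨j, i⟩)))) *
          g (∑ j, kv j) (β ∘ Fin.cast (bsum_eq_sum (m + 1) kv).symm) else 0) =
      Fs (Fin.init kv) (kv (Fin.last m)) := by
    intro kv
    rw [fragH_peel]
    simp only [hFs, Fin.init_snoc, Fin.snoc_last]
  rw [Finset.sum_congr rfl fun kv _ => hpeel kv, sum_piFinset_init_last S Fs]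
  -- the inner sum over the size of the block of `b`
  have hinner : ∀ kv' : Fin m → ℕ, ∑ k ∈ S, Fs kv' k =
      (1 / b) * multiSlice m kv' ζ (fun β' => if ∀ t, η ≤ β' t then
        (∏ j : Fin m, blockWeight γ (kv' j) (fun i =>
            β' (Fin.cast (bsum_eq_sum m kv').symm (finSigmaFinEquiv (n := kv') ⟨j, i⟩)))) *
          g' (∑ j, kv' j) (β' ∘ Fin.cast (bsum_eq_sum m kv').symm) else 0) := by
    intro kv'
    rw [← multiSlice_const_mul, Finset.sum_eq_single_of_mem 1 (Finset.mem_Icc.2 ⟨le_rfl, hN⟩)]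
    · simp only [hFs]
      refine multiSlice_congr m kv' ζ fun β' => ?_
      -- the block of `b` of size one: evaluation at `(b)` with weight `1/b` (Lemma 5.5 (b))
      simp only [sliceIntegral_one, if_pos hb0]
      by_cases hβ' : ∀ t, η ≤ β' t
      · rw [if_pos ⟨hβ', fun _ => hb⟩, if_pos hβ', blockWeight_one_eq _ hb0.le hb', Fin.append_right_eq_snoc]
        simp only [hg']
        rw [apply_snoc_eq_cast g kv' β' b]
        ring
      · rw [if_neg (fun h => hβ' h.1), if_neg hβ', mul_zero]
    · intro k hk hk1
      have hk2 : 2 ≤ k := by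
        have := (Finset.mem_Icc.1 hk).1
        omega
      simp only [hFs]
      -- the block of `b` of size `k ≥ 2`: weight `0` on `Δ_k(b)` (Lemma 5.5 (b))
      rw [multiSlice_congr m kv' ζ (H' := fun _ => 0) (fun β' => ?_), multiSlice_zero_fun]
      rw [sliceIntegral_congr (G' := fun _ => 0) (fun v hv hsum => ?_), sliceIntegral_zero]
      rw [blockWeight_eq_zero_of_sum_lt hk2 v (fun i => (hv i).le) (by rw [hsum]; exact hb'), mul_zero,
        zero_mul, ite_self]
  rw [Finset.sum_congr rfl fun kv' _ => hinner kv', ← Finset.mul_sum]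
  field_simp

/-- Appending small coordinates to bounded measurable data gives bounded measurable data. [folklore] -/
theorem measurable_append_data (g : VecFn) (hgm : ∀ n, Measurable (g n)) {s : ℕ} (b : Fin s → ℝ) (n : ℕ) :
    Measurable (fun v : Fin n → ℝ => g (n + s) (Fin.append v b)) :=
  (hgm (n + s)).comp (measurable_append_left b)

/-- **Small coordinates pass through the fragmentation operator**: for `0 < η ≤ 1`, `g` bounded and
measurable in each dimension, `ζ ∈ ℝ^r` arbitrary and `b ∈ [η, 1 - γ)^s`,
`fragOp γ η g (ζ, b) = fragOp γ η g_b (ζ)` where `g_b(v) = g(v, b)` ("only the components `≥ 1 - γ` are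
genuinely fragmented"). [cite: FordMaynard2024PrimeSieves, §6.1 (remarks after (6.3)) and Theorem 6.4 (fsl)] -/
theorem fragOp_append_small (hη : 0 < η) (hη1 : η ≤ 1) :
    ∀ (s : ℕ) (g : VecFn), (∀ n, Measurable (g n)) → ∀ {F : ℝ}, (∀ n v, |g n v| ≤ F) →
      ∀ {r : ℕ} (ζ : Fin r → ℝ) (b : Fin s → ℝ), (∀ i, η ≤ b i) → (∀ i, b i < 1 - γ) →
        fragOp γ η g (r + s) (Fin.append ζ b) = fragOp γ η (fun n v => g (n + s) (Fin.append v b)) r ζ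
  | 0, g, hgm, F, hF, r, ζ, b, hb, hb' => by
    obtain rfl : b = Fin.elim0 := funext fun i => i.elim0
    have hg : (fun (n : ℕ) (v : Fin n → ℝ) => g (n + 0) (Fin.append v Fin.elim0)) = g := by
      funext n v
      rw [Fin.append_elim0]
      exact VecFn.apply_congr g (Nat.add_zero n) _ _ fun i => rfl
    rw [hg, Fin.append_elim0]
    exact VecFn.apply_congr (fragOp γ η g) (Nat.add_zero r) _ _ fun i => rfl
  | s + 1, g, hgm, F, hF, r, ζ, b, hb, hb' => by
    rw [← Fin.snoc_init_self b]
    simp only [Fin.append_snoc]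
    show fragOp γ η g (r + s + 1) (Fin.snoc (α := fun _ => ℝ) (Fin.append ζ (Fin.init b)) (b (Fin.last s))) =
      fragOp γ η (fun n v => g (n + s + 1)
        (Fin.snoc (α := fun _ => ℝ) (Fin.append v (Fin.init b)) (b (Fin.last s)))) r ζ
    rw [fragOp_snoc_small hη hη1 g hgm hF _ (hb _) (hb' _),
      fragOp_append_small hη hη1 s _ (measurable_snoc_data g hgm _) (fun n v => hF _ _) ζ (Fin.init b)
        (fun i => hb _) (fun i => hb' _)]

/-- **(fsl) with one large coordinate, the large coordinate first**: for `0 < η ≤ 1`, `g` bounded and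
measurable in each dimension, `α ∈ ℝ` and `b ∈ [η, 1 - γ)^s`,
`fragOp γ η g (α, b) = α ∑_{n=1}^{⌊1/η⌋} ∫_{v ∈ Δ_n(α)} 𝟙[v ≥ η] 𝓛_{1-γ}(v)/(n! v₁⋯v_n) · g(v, b) dv`
(the small coordinates are not fragmented and their weights `1/bᵢ` cancel against `ξ₁⋯ξ_m`).
[cite: FordMaynard2024PrimeSieves, Theorem 6.4 (fsl) and §6.1 (6.3)] -/
theorem fragOp_one_append_small_eq_sum_sliceIntegral (hη : 0 < η) (hη1 : η ≤ 1) (g : VecFn)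
    (hgm : ∀ n, Measurable (g n)) {F : ℝ} (hF : ∀ n v, |g n v| ≤ F) (α : ℝ) {s : ℕ} (b : Fin s → ℝ)
    (hb : ∀ i, η ≤ b i) (hb' : ∀ i, b i < 1 - γ) :
    fragOp γ η g (1 + s) (Fin.append (fun _ : Fin 1 => α) b) =
      α * ∑ n ∈ Finset.Icc 1 (maxBlock η), sliceIntegral n α
        (fun v => if ∀ t, η ≤ v t then blockWeight γ n v * g (n + s) (Fin.append v b) else 0) := by
  rw [fragOp_append_small hη hη1 s g hgm hF _ b hb hb',
    fragOp_one_eq_sum_sliceIntegral hη _ (measurable_append_data g hgm b) (fun n v => hF _ _)]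

/-- A vector is a permutation of `(ξ_j, ξ with the j-th entry removed)`: `ξ = cons (ξ j) (ξ ∘ j.succAbove) ∘ σ`
for the permutation `σ` of `Fin (s + 1)` sending `j ↦ 0` and `j.succAbove i ↦ i.succ`. [folklore] -/
theorem eq_cons_comp_perm {s : ℕ} (ξ : Fin (s + 1) → ℝ) (j : Fin (s + 1)) :
    ξ = (Fin.cons (ξ j) (fun i => ξ (j.succAbove i)) : Fin (s + 1) → ℝ) ∘
      ((finSuccEquiv' j).trans (finSuccEquiv s).symm) := by
  funext x
  rcases Fin.eq_self_or_eq_succAbove j x with rfl | ⟨i, rfl⟩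
  · simp
  · simp

/-- **(fsl) at a vector with a distinguished coordinate** `j` all of whose OTHER coordinates are small:
for `g ∈ 𝒮` bounded and measurable in each dimension, `0 < η ≤ 1`, `ξ ∈ ℝ^{s+1}` with `ξᵢ ∈ [η, 1 - γ)`
for `i ≠ j`,
`fragOp γ η g (ξ) = ξ_j ∑_{n=1}^{⌊1/η⌋} ∫_{v ∈ Δ_n(ξ_j)} 𝟙[v ≥ η] 𝓛_{1-γ}(v)/(n! ∏v) · g(v, ξ_{≠ j}) dv`,
`ξ_{≠ j} = (ξ_{j.succAbove i})_i` the other coordinates in order — Ford–Maynard's `f_{s,1}(β, α)/1` with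
`α = ξ_j`, `β = ξ_{≠ j}` (for `ξ_j ≥ 1 - γ` the `n = 1` term vanishes, Lemma 5.5 (a)).
[cite: FordMaynard2024PrimeSieves, Theorem 6.4 (fsl) and §8 (the functions f_{s,1})] -/
theorem fragOp_eq_sum_sliceIntegral_of_others_small (hη : 0 < η) (hη1 : η ≤ 1) {g : VecFn}
    (hs : g.IsSymmetric) (hgm : ∀ n, Measurable (g n)) {F : ℝ} (hF : ∀ n v, |g n v| ≤ F) {s : ℕ}
    (ξ : Fin (s + 1) → ℝ) (j : Fin (s + 1)) (hsmall : ∀ i, i ≠ j → η ≤ ξ i ∧ ξ i < 1 - γ) :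
    fragOp γ η g (s + 1) ξ =
      ξ j * ∑ n ∈ Finset.Icc 1 (maxBlock η), sliceIntegral n (ξ j)
        (fun v => if ∀ t, η ≤ v t then
          blockWeight γ n v * g (n + s) (Fin.append v (fun i => ξ (j.succAbove i))) else 0) := by
  set b : Fin s → ℝ := fun i => ξ (j.succAbove i) with hbdef
  have hb : ∀ i, η ≤ b i := fun i => (hsmall _ (Fin.succAbove_ne j i)).1
  have hb' : ∀ i, b i < 1 - γ := fun i => (hsmall _ (Fin.succAbove_ne j i)).2
  rw [← fragOp_one_append_small_eq_sum_sliceIntegral hη hη1 g hgm hF (ξ j) b hb hb']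
  conv_lhs => rw [eq_cons_comp_perm ξ j]
  rw [fragOp_comp_perm hs]
  refine VecFn.apply_congr (fragOp γ η g) (Nat.add_comm s 1) _ _ fun i => ?_
  rw [Fin.append_left_eq_cons]
  exact congrArg (Fin.cons (ξ j) b) (Fin.ext rfl)

end Summit.Parity.GeneralizedHardyLittlewood.FordMaynardNoSieveConst0164NegWitness0164

end
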